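import Summits.RiemannHypothesis.RiemannHypothesis.Theses.GapsEvoDoors
import Literature.NumberTheory.LFunctions.ZetaSpacingDensityDistinctGaps

/-!
# GapsEvoDoors — `SimpleFromNStar` (item stmt-RiemannHypothesis-23130): the counting bridge `N⁽¹⁾ ≥ 2N − N*`

Route `GapsEvoDoors`, support `SimpleFromNStar` (door (a″), provable-now counting bridge;
Titchmarsh §14.34 / Chirre–Gonçalves–de Laat 2020 §1): on RH, if `Σ_{γ_d ≤ T} m(γ_d)² ≤ ν N(T)`
for all large `T` (the tree's `BGMM2023.multPairCount`, ordered pairs of indices with equal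
ordinates), then for every `η > 0`, eventually `N⁽¹⁾(T) ≥ (2 − ν − η) N(T)` (simple zeros on the
critical line, `simpleCriticalZeroCount`). Proof: over the distinct zeros `ρ` of the box
`0 < Im ρ ≤ T` (all critical on RH), `N = Σ m(ρ)`, `N⁽¹⁾ = #{m = 1}` and `Σ m(ρ)² = N*(T)`
(`CGdL2020.nStar`) `= multPairCount T` on RH (tree `BGMM2023.multPairCount_eq_nStar_of_RH`), while
pointwise `2m − m² ≤ [m = 1]` (tree `two_mul_sum_sub_sum_sq_le_card_filter_eq_one`); so
`N⁽¹⁾ ≥ 2N − N* ≥ (2 − ν) N ≥ (2 − ν − η) N`. This is the tree's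
`Montgomery1973_simple_zeros_of_sum_sq_multiplicity` (`SimpleZeros.lean`) with the constant `4/3`
replaced by a parameter and the hypothesis read in the index vocabulary. RH is the antecedent.
RH-sentence (c): a record INSIDE route GapsEvoDoors (door (a″) bookkeeping) — toward
RiemannHypothesis: 0. Nothing here bears on the truth of RH.
-/

noncomputable section

open Filter Set Literature.NumberTheory Literature.NumberTheory.LFunctions
open Literature.NumberTheory.LFunctions.BGMM2023

set_option linter.dupNamespace false  -- the mandated namespace repeats `RiemannHypothesis`

namespace Summit.RiemannHypothesis.RiemannHypothesis.Theorems.GapsEvoDoorsSimple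

/-- **`N⁽¹⁾(T) ≥ 2N(T) − Σ_{γ_d ≤ T} m(γ_d)²` on RH** (Titchmarsh §14.34: `2m − m² ≤ [m = 1]` summed
over the distinct zeros of the box, all on the critical line; `Σ m² = N* = multPairCount`). -/
theorem two_mul_count_sub_multPairCount_le (hRH : _root_.RiemannHypothesis) (T : ℝ) :
    2 * (zetaZeroCount T : ℝ) - (multPairCount T : ℝ) ≤ (simpleCriticalZeroCount T : ℝ) := by
  classical
  have hB : (zetaZeroBox 0 T).Finite := zetaZeroBox_finite 0 T
  set s : Finset ℂ := hB.toFinset with hs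
  have hpos : ∀ ρ ∈ s, 1 ≤ riemannZetaZeroOrder ρ := fun ρ hρ ↦
    DiophantineGeometry.riemannZetaZeroOrder_pos_of_mem_zetaZeroBox ((Set.Finite.mem_toFinset hB).1 hρ)
  -- `N(T) = Σ_s m`
  have hN : (zetaZeroCount T : ℤ) = ∑ ρ ∈ s, riemannZetaZeroOrder ρ := by
    have hsum : ∑ᶠ ρ ∈ zetaZeroBox 0 T, riemannZetaZeroOrder ρ =
        ∑ ρ ∈ s, riemannZetaZeroOrder ρ :=
      finsum_mem_eq_finite_toFinset_sum _ hB
    have hnn : 0 ≤ ∑ ρ ∈ s, riemannZetaZeroOrder ρ :=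
      Finset.sum_nonneg fun ρ hρ ↦ zero_le_one.trans (hpos ρ hρ)
    simp only [zetaZeroCount, zetaZeroCountRe, hsum]
    exact Int.toNat_of_nonneg hnn
  -- `multPairCount T = N*(T) = Σ_s m²`
  have hS : (multPairCount T : ℤ) = ∑ ρ ∈ s, riemannZetaZeroOrder ρ ^ 2 := by
    rw [multPairCount_eq_nStar_of_RH hRH T, CGdL2020.nStar]
    exact finsum_mem_eq_finite_toFinset_sum _ hB
  -- `N⁽¹⁾(T) = #{ρ ∈ s : m(ρ) = 1}` (RH puts every zero of the box on the line)
  have hset : {ρ ∈ zetaZeroBox 0 T | riemannZetaZeroOrder ρ = 1} =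
      ↑(s.filter fun ρ ↦ riemannZetaZeroOrder ρ = 1) := by
    ext ρ
    simp [hs, Set.Finite.mem_toFinset]
  have hN1 : (simpleCriticalZeroCount T : ℤ) =
      ((s.filter fun ρ ↦ riemannZetaZeroOrder ρ = 1).card : ℤ) := by
    simp only [simpleCriticalZeroCount, simpleCriticalZeros_eq_of_rh hRH T, hset,
      Set.ncard_coe_finset]
  have key := two_mul_sum_sub_sum_sq_le_card_filter_eq_one s riemannZetaZeroOrder hpos
  rw [← hN, ← hS, ← hN1] at key
  exact_mod_cast key

/-- **`SimpleFromNStar` holds** (item stmt-RiemannHypothesis-23130 of route GapsEvoDoors): on RH,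
`Σ m(γ_d)² ≤ ν N(T)` eventually ⇒ `N⁽¹⁾(T) ≥ (2 − ν − η) N(T)` eventually, for every `η > 0`
(`two_mul_count_sub_multPairCount_le`). A record INSIDE the route (door (a″) counting bridge);
toward RiemannHypothesis: 0. -/
theorem SimpleFromNStar_holds :
    Summit.RiemannHypothesis.RiemannHypothesis.Theses.GapsEvoDoors.SimpleFromNStar := by
  unfold Summit.RiemannHypothesis.RiemannHypothesis.Theses.GapsEvoDoors.SimpleFromNStar
  intro hRH ν hν η hη
  obtain ⟨T₀, hT₀⟩ := hν
  filter_upwards [eventually_ge_atTop T₀] with T hT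
  have h1 := hT₀ T hT
  have h2 := two_mul_count_sub_multPairCount_le hRH T
  have hN0 : (0 : ℝ) ≤ zetaZeroCount T := Nat.cast_nonneg _
  nlinarith

end Summit.RiemannHypothesis.RiemannHypothesis.Theorems.GapsEvoDoorsSimple

end
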